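import Literature.AlgebraicGeometry.Motives.Cycles
import Literature.AlgebraicGeometry.Motives.CompleteIntersection
import Mathlib.FieldTheory.IsAlgClosed.Basic
import HarnessLib

/-!
# `CH₁` of a low-degree smooth complete intersection is generated by lines (Tian–Zong 2014)

Z. Tian and H. R. Zong, *One-cycles on rationally connected varieties*, Compositio Math. **150**
(2014) 396–408 [TianZong2014], Theorem 1.7 (= Theorem 6.1 of the body of the paper):

> Let `X` be a smooth complete intersection of type `(d₁, …, d_c)` (in `ℙⁿ`) over an
> algebraically closed field `k`. Assume `d₁ + ⋯ + d_c ≤ n − 1`. If `char k = p > 0`, also assume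
> that `X` is separably rationally connected. Then the Chow group of `1`-cycles `CH₁(X)` is
> generated by lines.

This file vendors the **characteristic-zero case** of that theorem as the named fact
`TianZong2014_chowOne_generatedByLines` on the tree's carriers:

* cycles, rational equivalence and Chow groups from `Motives/Cycles` (`cyclesOfDim`, `primeCycle`,
  `IsRationallyEquivalent`, `ChowGroup`);
* smooth complete intersections from `Motives/CompleteIntersection`: the hypotheses of the fact
  are exactly the constituents of `IsSmoothCompleteIntersection n d X` (a smooth projective
  geometrically irreducible `n`-fold cut out in `ℙⁿ⁺ᶜ_k` by forms `F₁, …, F_c` of degrees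
  `d₁, …, d_c ≥ 1` satisfying the Jacobian condition `IsNonsingularSystem`, whence
  `X = V₊(F₁) ∩ ⋯ ∩ V₊(F_c)` scheme-theoretically — see the module docstring of
  `Motives/CompleteIntersection` for why the Jacobian condition is what makes this faithful), but
  with the witnesses `(F, i)` **exposed**, because "line of `X`" refers to the embedding
  `i : X ↪ ℙⁿ⁺ᶜ`. (Reducedness of `X`, part of `IsCutOutBy`, is automatic for `X` smooth over `k`
  and is not repeated.)
* lines: `IsLinePoint N i z` says that the point `z` of `X` is the generic point of a **line**
  of `X ⊆ ℙᴺ`, i.e. `z` has dimension `1` (`Order.height z = 1` in the specialisation order) and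
  the image of its closure under `i` is a linear `ℙ¹ = V₊(L₁, …, L_{N−1})` for `N − 1` linearly
  independent linear forms. The class of that line in `CH₁(X)` is the class of `primeCycle z`.

"`CH₁(X)` is generated by lines" is rendered at the level of cycles (`ChowOneGeneratedByLines`:
every `1`-cycle is rationally equivalent to an integral combination of prime cycles of lines) and
proved equivalent to the literal reading "the subgroup of `CH₁(X)` generated by the line classes
is everything" (`chowOneGeneratedByLines_iff_closure_lineClasses_eq_top`).

## Scope (what is NOT vendored)

* The positive-characteristic clause of Thm. 1.7 (which needs *separable rational connectedness*,
  a notion the tree does not have) is dropped: the fact quantifies over algebraically closed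
  fields of characteristic `0` only, a sub-case of the printed statement.
* Thm. 1.3 (`CH₁` of a separably rationally connected variety is generated by rational curves),
  Thm. 1.6 and Cor. 1.9 (`CH₁(X) ≅ ℤ` when `∑ dᵢ(dᵢ+1)/2 ≤ n`) are not stated here.

## References

* [TianZong2014] Z. Tian, H. R. Zong, *One-cycles on rationally connected varieties*, Compositio
  Math. 150 (2014), no. 3, 396–408, doi:10.1112/S0010437X13007549; arXiv:1209.4342 (Thm. 1.7 on
  p. 3, proved as Thm. 6.1 in §6).
* W. Fulton, *Intersection Theory*, §1.3 (cycles, rational equivalence). [Fulton1998]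
* R. Hartshorne, *Algebraic Geometry*, II Ex. 8.4 (complete intersections). [Hartshorne1977]
-/

noncomputable section

open CategoryTheory AlgebraicGeometry

universe u

namespace Literature.AlgebraicGeometry.Motives

attribute [local instance] MvPolynomial.gradedAlgebra

/-! ### Lines on an embedded projective `k`-scheme -/

section Lines

variable {k : Type u} [Field k]

/-- **Lines of `X ⊆ ℙᴺ_k`.** For a `k`-scheme `X` with a `k`-morphism `i : X ⟶ ℙᴺ_k` (a closed
immersion in all uses), the point `z` of `X` *is (the generic point of) a line of `X`* if its
closure `closure {z} ⊆ X` is one-dimensional (`Order.height z = 1` for the specialisation order,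
i.e. `dim closure {z} = 1`, the grading of `cyclesOfDim X 1`) and is mapped by `i` onto a linear
subspace `V₊(L₁, …, L_{N-1}) ⊆ ℙᴺ = Proj k[x₀, …, x_N]` cut out by `N - 1` linearly independent
linear forms, i.e. onto a line of `ℙᴺ`. Its class in `CH₁(X)` is the class of the prime cycle
`primeCycle z` (Fulton, *Intersection Theory* §1.3). This is the rendering of "line" used by the
route `Summits/HodgeConjecture/HodgeConjecture/Theses/SchlafliMinusFive` (`N = 8`, seven forms).
[folklore] -/
def IsLinePoint (N : ℕ) {X : SchemeOver k} (i : X ⟶ projectiveSpace N k) (z : ↥X.left) : Prop :=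
  Order.height z = 1 ∧
    ∃ L : Fin (N - 1) → MvPolynomial (Fin (N + 1)) k, LinearIndependent k L ∧
      (∀ j, (L j).IsHomogeneous 1) ∧
        ⇑i.left.base '' closure {z} =
          ProjectiveSpectrum.zeroLocus (MvPolynomial.homogeneousSubmodule (Fin (N + 1)) k)
            (Set.range L)

variable {N : ℕ} {X : SchemeOver k} {i : X ⟶ projectiveSpace N k}

/-- Unfolding of `IsLinePoint` (`Iff.rfl`). [folklore] -/
theorem isLinePoint_iff (z : ↥X.left) :
    IsLinePoint N i z ↔ Order.height z = 1 ∧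
      ∃ L : Fin (N - 1) → MvPolynomial (Fin (N + 1)) k, LinearIndependent k L ∧
        (∀ j, (L j).IsHomogeneous 1) ∧
          ⇑i.left.base '' closure {z} =
            ProjectiveSpectrum.zeroLocus (MvPolynomial.homogeneousSubmodule (Fin (N + 1)) k)
              (Set.range L) :=
  Iff.rfl

/-- The generic point of a line has dimension `1` (with the `ℕ`-cast expected by
`primeCycle_mem_cyclesOfDim` / `ChowGroup.ofPoint`). [folklore] -/
theorem IsLinePoint.height_eq_one {z : ↥X.left} (h : IsLinePoint N i z) :
    Order.height z = ((1 : ℕ) : ℕ∞) := by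
  simpa using h.1

/-- The prime cycle of a line is a `1`-cycle. [folklore] -/
theorem IsLinePoint.primeCycle_mem {z : ↥X.left} (h : IsLinePoint N i z) :
    primeCycle z ∈ cyclesOfDim X.left 1 :=
  primeCycle_mem_cyclesOfDim h.height_eq_one

/-- Integral combinations of prime cycles of lines are `1`-cycles. [folklore] -/
theorem sum_zsmul_primeCycle_mem_cyclesOfDim {s : Finset ↥X.left} (w : ↥X.left → ℤ)
    (hs : ∀ z ∈ s, IsLinePoint N i z) :
    (∑ z ∈ s, w z • primeCycle z) ∈ cyclesOfDim X.left 1 :=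
  AddSubgroup.sum_mem _ fun z hz => AddSubgroup.zsmul_mem _ (hs z hz).primeCycle_mem _

/-- The set of **line classes** `[ℓ] ∈ CH₁(X)`: classes `ChowGroup.ofPoint z _` of the prime
cycles of the lines `z` of `X ⊆ ℙᴺ` (Fulton §1.3). [folklore] -/
def lineClasses (N : ℕ) {X : SchemeOver k} (i : X ⟶ projectiveSpace N k) :
    Set (ChowGroup X.left 1) :=
  {x | ∃ (z : ↥X.left) (hz : IsLinePoint N i z), x = ChowGroup.ofPoint z hz.height_eq_one}

/-- The class of a line is a line class. [folklore] -/
theorem ofPoint_mem_lineClasses {z : ↥X.left} (hz : IsLinePoint N i z) :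
    ChowGroup.ofPoint z hz.height_eq_one ∈ lineClasses N i :=
  ⟨z, hz, rfl⟩

/-- **`CH₁(X)` is generated by lines** (a PREDICATE of the embedded scheme `i : X ⟶ ℙᴺ`, not a
named fact), rendered on cycles: every `1`-cycle `γ ∈ Z₁(X)` is rationally equivalent (as a
`1`-cycle, `IsRationallyEquivalent … 1`, Fulton §1.3) to an integral combination
`∑_{z ∈ s} w z • [closure {z}]` of prime cycles of finitely many lines `z` of `X ⊆ ℙᴺ`. Equivalent
to `AddSubgroup.closure (lineClasses N i) = ⊤`
(`chowOneGeneratedByLines_iff_closure_lineClasses_eq_top`). [folklore] -/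
def ChowOneGeneratedByLines (N : ℕ) {X : SchemeOver k} (i : X ⟶ projectiveSpace N k) : Prop :=
  ∀ γ ∈ cyclesOfDim X.left 1, ∃ (s : Finset ↥X.left) (w : ↥X.left → ℤ),
    (∀ z ∈ s, IsLinePoint N i z) ∧ IsRationallyEquivalent γ (∑ z ∈ s, w z • primeCycle z) 1

/-- The class of an integral combination of prime cycles of lines lies in the subgroup generated by
the line classes. [folklore] -/
theorem mk_sum_zsmul_primeCycle_mem_closure_lineClasses {s : Finset ↥X.left} (w : ↥X.left → ℤ)
    (hs : ∀ z ∈ s, IsLinePoint N i z) :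
    ChowGroup.mk X.left 1 ⟨∑ z ∈ s, w z • primeCycle z, sum_zsmul_primeCycle_mem_cyclesOfDim w hs⟩ ∈
      AddSubgroup.closure (lineClasses N i) := by
  have : (⟨∑ z ∈ s, w z • primeCycle z, sum_zsmul_primeCycle_mem_cyclesOfDim w hs⟩ :
      ↥(cyclesOfDim X.left 1)) =
      ∑ z ∈ s.attach, w z • ⟨primeCycle (z : ↥X.left), (hs z z.2).primeCycle_mem⟩ := by
    apply Subtype.ext
    rw [AddSubgroup.val_finsetSum]
    simp only [AddSubgroup.coe_zsmul]
    exact (Finset.sum_attach s (fun z => w z • primeCycle z)).symm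
  rw [this, map_sum]
  refine AddSubgroup.sum_mem _ fun z _ => ?_
  rw [map_zsmul]
  exact AddSubgroup.zsmul_mem _
    (AddSubgroup.subset_closure (k := lineClasses N i) ⟨z, hs z z.2, rfl⟩) _

/-- Cycle level ⇒ Chow-group level: if every `1`-cycle is rationally equivalent to an integral
combination of lines, the line classes generate `CH₁(X)`. [folklore] -/
theorem ChowOneGeneratedByLines.closure_lineClasses_eq_top (h : ChowOneGeneratedByLines N i) :
    AddSubgroup.closure (lineClasses N i) = ⊤ := by
  rw [eq_top_iff]
  rintro x -
  induction x using ChowGroup.induction_on with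
  | h γ =>
    obtain ⟨s, w, hs, hrat⟩ := h γ γ.2
    have hmk : ChowGroup.mk X.left 1 γ =
        ChowGroup.mk X.left 1 ⟨_, sum_zsmul_primeCycle_mem_cyclesOfDim w hs⟩ :=
      ChowGroup.mk_eq_mk_iff.mpr hrat
    rw [hmk]
    exact mk_sum_zsmul_primeCycle_mem_closure_lineClasses w hs

/-- An element of the subgroup of `CH₁(X)` generated by the line classes is the class of an
integral combination of prime cycles of finitely many lines (bookkeeping by
`AddSubgroup.closure_induction`). [folklore] -/
theorem exists_eq_mk_sum_of_mem_closure_lineClasses {x : ChowGroup X.left 1}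
    (hx : x ∈ AddSubgroup.closure (lineClasses N i)) :
    ∃ (s : Finset ↥X.left) (w : ↥X.left → ℤ) (hs : ∀ z ∈ s, IsLinePoint N i z),
      x = ChowGroup.mk X.left 1
        ⟨∑ z ∈ s, w z • primeCycle z, sum_zsmul_primeCycle_mem_cyclesOfDim w hs⟩ := by
  classical
  induction hx using AddSubgroup.closure_induction with
  | mem x hx =>
    obtain ⟨z, hz, rfl⟩ := hx
    refine ⟨{z}, fun _ => 1, by simpa using hz, ?_⟩
    simp only [ChowGroup.ofPoint]
    congr 1
    exact Subtype.ext (by simp)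
  | zero =>
    refine ⟨∅, 0, by simp, ?_⟩
    have h0 : (⟨∑ z ∈ (∅ : Finset ↥X.left), (0 : ↥X.left → ℤ) z • primeCycle z,
        sum_zsmul_primeCycle_mem_cyclesOfDim (N := N) (i := i) 0 (by simp)⟩ :
        ↥(cyclesOfDim X.left 1)) = 0 :=
      Subtype.ext (by simp)
    rw [h0, map_zero]
  | add x y _ _ ihx ihy =>
    obtain ⟨s₁, w₁, hs₁, rfl⟩ := ihx
    obtain ⟨s₂, w₂, hs₂, rfl⟩ := ihy
    have hs : ∀ z ∈ s₁ ∪ s₂, IsLinePoint N i z := by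
      intro z hz
      rcases Finset.mem_union.mp hz with hz | hz
      exacts [hs₁ z hz, hs₂ z hz]
    refine ⟨s₁ ∪ s₂, fun z => (if z ∈ s₁ then w₁ z else 0) + (if z ∈ s₂ then w₂ z else 0), hs, ?_⟩
    rw [← map_add]
    congr 1
    apply Subtype.ext
    simp only [AddSubgroup.coe_add, add_zsmul, Finset.sum_add_distrib, ite_smul, zero_smul,
      Finset.sum_ite_mem, Finset.union_inter_cancel_left, Finset.union_inter_cancel_right]
  | neg x _ ih =>
    obtain ⟨s, w, hs, rfl⟩ := ih
    refine ⟨s, fun z => -w z, hs, ?_⟩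
    rw [← map_neg]
    congr 1
    apply Subtype.ext
    simp only [AddSubgroup.coe_neg, neg_zsmul, Finset.sum_neg_distrib]

/-- Chow-group level ⇒ cycle level. [folklore] -/
theorem chowOneGeneratedByLines_of_closure_lineClasses_eq_top
    (h : AddSubgroup.closure (lineClasses N i) = ⊤) : ChowOneGeneratedByLines N i := by
  intro γ hγ
  have hx : ChowGroup.mk X.left 1 ⟨γ, hγ⟩ ∈ AddSubgroup.closure (lineClasses N i) := by
    rw [h]; trivial
  obtain ⟨s, w, hs, hmk⟩ := exists_eq_mk_sum_of_mem_closure_lineClasses hx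
  exact ⟨s, w, hs, ChowGroup.mk_eq_mk_iff.mp hmk⟩

/-- **Equivalence of the two readings of "`CH₁(X)` is generated by lines"**: the cycle-level
rendering `ChowOneGeneratedByLines N i` holds iff the subgroup of `CH₁(X) = Z₁(X)/Rat₁(X)`
generated by the classes of lines is all of `CH₁(X)`. [folklore] -/
theorem chowOneGeneratedByLines_iff_closure_lineClasses_eq_top :
    ChowOneGeneratedByLines N i ↔ AddSubgroup.closure (lineClasses N i) = ⊤ :=
  ⟨ChowOneGeneratedByLines.closure_lineClasses_eq_top,
    chowOneGeneratedByLines_of_closure_lineClasses_eq_top⟩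

end Lines

/-! ### The named fact -/

/-- **Tian–Zong 2014, Theorem 1.7 (characteristic `0`).** *Let `X` be a smooth complete
intersection of type `(d₁, …, d_c)` in `ℙⁿ` over an algebraically closed field `k`. Assume
`d₁ + ⋯ + d_c ≤ n − 1`. If `char k = p > 0`, also assume that `X` is separably rationally
connected. Then the Chow group of `1`-cycles `CH₁(X)` is generated by lines* (integrally: every
`1`-cycle is rationally equivalent to a `ℤ`-combination of lines; Compositio Math. 150 (2014),
Thm. 1.7, proved as Thm. 6.1: `X` is rationally chain connected by lines, `CH₀` of the Fano scheme
of lines surjects onto `CH₁(X) ⊗ ℚ`, the cokernel on algebraically-trivial parts is torsion, and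
every rational curve is algebraically equivalent to an integral sum of lines, Thm. 1.6/6.2).

Rendering. Only the characteristic-`0` case is stated (`[CharZero k]`; the tree has no notion of
separable rational connectedness). With `N = n + c` the ambient dimension (`n = dim X`,
`c` = number of equations) the degree condition `∑ dᵢ ≤ N − 1` is written `∑ dᵢ + 1 ≤ n + c`.
"Smooth complete intersection of type `d`" is spelled by the constituents of
`IsSmoothCompleteIntersection n d X` (`Motives/CompleteIntersection`) with its witnesses exposed:
`X` smooth projective geometrically irreducible of dimension `n`, forms `F a` of degrees
`d a ≥ 1` on `ℙⁿ⁺ᶜ` satisfying the Jacobian condition `IsNonsingularSystem k F`, and a closed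
`k`-immersion `i : X ↪ ℙⁿ⁺ᶜ_k` with image `V₊(F₁, …, F_c)`; lines are taken with respect to `i`
(`IsLinePoint`, `ChowOneGeneratedByLines`). The instance used by the route
`SchlafliMinusFive` (`LinesGenerate23`) is `k = ℂ`, `n = 6`, `c = 2`, `d = (2, 3)`, `N = 8`.
[cite: TianZong2014, Thm. 1.7 (= Thm. 6.1); arXiv:1209.4342 p. 3] -/
def TianZong2014_chowOne_generatedByLines : Prop :=
  ∀ ⦃k : Type u⦄ [Field k] [IsAlgClosed k] [CharZero k] ⦃c : ℕ⦄ (n : ℕ) (d : Fin c → ℕ)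
    ⦃X : SchemeOver k⦄ (F : Fin c → MvPolynomial (Fin (n + c + 1)) k)
    (i : X ⟶ projectiveSpace (n + c) k),
    IsSmoothProjective n X → (∀ a, (F a).IsHomogeneous (d a)) → (∀ a, 0 < d a) →
      IsNonsingularSystem k F → IsClosedImmersion i.left →
        Set.range i.left.base =
          ProjectiveSpectrum.zeroLocus (MvPolynomial.homogeneousSubmodule (Fin (n + c + 1)) k)
            (Set.range F) →
          (∑ a, d a) + 1 ≤ n + c → ChowOneGeneratedByLines (n + c) i

/-- **Corollary (Chow-group form).** Under `TianZong2014_chowOne_generatedByLines`, for a smooth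
complete intersection `X ⊆ ℙⁿ⁺ᶜ_k` of multidegree `d` with `∑ dᵢ ≤ n + c − 1` over an
algebraically closed field of characteristic `0`, the line classes generate `CH₁(X)`:
`AddSubgroup.closure (lineClasses (n + c) i) = ⊤`. [cite: TianZong2014, Thm. 1.7] -/
theorem TianZong2014_chowOne_generatedByLines.closure_lineClasses_eq_top
    (h : TianZong2014_chowOne_generatedByLines.{u}) {k : Type u} [Field k] [IsAlgClosed k]
    [CharZero k] {c : ℕ} (n : ℕ) (d : Fin c → ℕ) {X : SchemeOver k}
    (F : Fin c → MvPolynomial (Fin (n + c + 1)) k) (i : X ⟶ projectiveSpace (n + c) k)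
    (hX : IsSmoothProjective n X) (hF : ∀ a, (F a).IsHomogeneous (d a)) (hd : ∀ a, 0 < d a)
    (hJ : IsNonsingularSystem k F) [hi : IsClosedImmersion i.left]
    (hV : Set.range i.left.base =
      ProjectiveSpectrum.zeroLocus (MvPolynomial.homogeneousSubmodule (Fin (n + c + 1)) k)
        (Set.range F))
    (hdeg : (∑ a, d a) + 1 ≤ n + c) :
    AddSubgroup.closure (lineClasses (n + c) i) = ⊤ :=
  (h n d F i hX hF hd hJ hi hV hdeg).closure_lineClasses_eq_top

/-- **Corollary (every class is a combination of lines).** Under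
`TianZong2014_chowOne_generatedByLines`, every class `x ∈ CH₁(X)` of such a complete intersection
is the class of an integral combination of prime cycles of finitely many lines.
[cite: TianZong2014, Thm. 1.7] -/
theorem TianZong2014_chowOne_generatedByLines.exists_eq_mk_sum
    (h : TianZong2014_chowOne_generatedByLines.{u}) {k : Type u} [Field k] [IsAlgClosed k]
    [CharZero k] {c : ℕ} (n : ℕ) (d : Fin c → ℕ) {X : SchemeOver k}
    (F : Fin c → MvPolynomial (Fin (n + c + 1)) k) (i : X ⟶ projectiveSpace (n + c) k)
    (hX : IsSmoothProjective n X) (hF : ∀ a, (F a).IsHomogeneous (d a)) (hd : ∀ a, 0 < d a)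
    (hJ : IsNonsingularSystem k F) [hi : IsClosedImmersion i.left]
    (hV : Set.range i.left.base =
      ProjectiveSpectrum.zeroLocus (MvPolynomial.homogeneousSubmodule (Fin (n + c + 1)) k)
        (Set.range F))
    (hdeg : (∑ a, d a) + 1 ≤ n + c) (x : ChowGroup X.left 1) :
    ∃ (s : Finset ↥X.left) (w : ↥X.left → ℤ) (hs : ∀ z ∈ s, IsLinePoint (n + c) i z),
      x = ChowGroup.mk X.left 1
        ⟨∑ z ∈ s, w z • primeCycle z, sum_zsmul_primeCycle_mem_cyclesOfDim w hs⟩ :=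
  exists_eq_mk_sum_of_mem_closure_lineClasses
    ((h.closure_lineClasses_eq_top n d F i hX hF hd hJ hV hdeg).symm ▸ AddSubgroup.mem_top x)

end Literature.AlgebraicGeometry.Motives

end
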